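import Literature.Probability.Percolation.MarkedLoopTemperleyLieb
import Literature.Probability.Percolation.MarkedLoopBraidTwist
import HarnessLib

/-!
# The tripod-law solution space in Temperley–Lieb link-pattern coordinates («TRIPOD-TL-COORDS»)

Topic `Literature/Probability/Percolation`; a rider on `MarkedLoopTemperleyLieb.lean` («TRIPOD-TL-BRIDGE»: `ncMatchingEquivLinkPattern : NCMatching n ≃
TemperleyLieb.LinkPattern n`, `toPM_closeUp_gonNext`, `toPM_closeUp_gonCap`, `isNonCrossing_pmRelabel_rot_pow`, `isNonCrossing_connect_last_zero`) and
`MarkedLoopBraidTwist.lean` («TWIST»: `rotOp`-conjugacy bookkeeping). It states the lane's rotation theorem ENTIRELY IN THE COORDINATES OF THE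
TEMPERLEY–LIEB LAYER `LatticeModels/TemperleyLiebLinkPatterns.lean` (Pearce–Rittenberg–de Gier–Nienhuis 2002):

* `pat₀EquivLinkPattern k : Pat₀ k ≃ LinkPattern (k+1)` (close up, then read the pairing) and ★★ `solWLinkEquiv k : solW k ≃ₗ[ℂ] (LinkPattern (k+1) → ℂ)` —
  THE TRIPOD-LAW SOLUTION SPACE OF KHRISTOFOROV–SMIRNOV'S `k`-DISORDER OBSERVABLES IS THE SPACE OF FUNCTIONS ON THE LINK PATTERNS OF `k+1` SITES;
* `lpRot` (the polygon rotation of a link pattern), `lpCapRot` (Pearce–Rittenberg–de Gier–Nienhuis's move `connect * 0` after it — planar by the bridge file) and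
  ★ `tlBraid` — THE TEMPERLEY–LIEB BRAID `(B φ)(P) = A⁻¹·φ(ρP) + A·φ((ρP).connect * 0)`, `A = −τ²`, `A⁻¹ = −τ`, a linear operator on `LinkPattern (k+1) → ℂ`;
* ★★★ `solWLinkEquiv_solWRot` — **`solWLinkEquiv (rot·w) = tlBraid (solWLinkEquiv w)`**: in link-pattern coordinates the relabelling rotation of the `k` marks IS
  the Temperley–Lieb braid; ★★ `tlBraid_eq_conj` / `tlBraid_pow` (conjugate to `rotOp k m`), ★★★ `tlBraid_pow_marks` (`B^k = 1`: the full twist is trivial),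
  ★★ `trace_tlBraid_pow_eq_zero` (`3 ∤ k`, `k ∤ r`: `tr B^r = 0`), `trace_tlBraid_pow_marks` (`tr B^k = #LinkPattern (k+1)`, Catalan).

* (ed. 2, «TRIPOD-ROTINV») `lpRotInv` (`ρ⁻¹`), `lpCapPred` (Pearce–Rittenberg–de Gier–Nienhuis's move at the edge `{k−1, *}`), the conjugations
  `lpRotInv_linkPatternCapLastZero` / `lpRot_lpCapPred` (`ρ⁻¹ e_{*,0} = e_{k−1,*} ρ⁻¹`), ★ `tlBraidInv` — Kauffman's INVERSE generator `A·1 + A⁻¹·e` after `ρ⁻¹` —,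
  ★★ `tlBraid_tlBraidInv` / `tlBraidInv_tlBraid` (UNITARITY `(A⁻¹ + Ae)(A + A⁻¹e) = 1` in coordinates), `tlBraidInv_eq_pow` (`B⁻¹ = B^{k−1}`), and ★★★
  `solWLinkEquiv_solWRot_symm` / `solWLinkEquiv_rotOp_pred` / `solWRot_symm_apply_outermost` — **`(rot⁻¹·w)(S) = A·w(ρ⁻¹S) + A⁻¹·w(e_{k−1,*} ρ⁻¹ S)`**: THE
  INVERSE ROTATION OF THE MARKS IS THE INVERSE TEMPERLEY–LIEB BRAID (the `ℤ[τ]`-checked formula of `HOME/FINDING-TRIPOD-SKEIN.md` §2, now a theorem for every `k`).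

Status in print: as for the bridge file (identification = the lane's, not located in print, conditional on [KK]; the move / loop weight / link patterns
are Pearce–Rittenberg–de Gier–Nienhuis's, the braid form Kauffman's, the tripod law Khristoforov–Smirnov's at `k = 3`).

## References
* M. Khristoforov, S. Smirnov, *Percolation and O(1) loop model*, arXiv:2111.15612 (2021), §1.2 (arXiv v1 p. 2), §2 Lemma 4, Fig. 3 (p. 4).
* P. A. Pearce, V. Rittenberg, J. de Gier, B. Nienhuis, J. Phys. A 35 (2002) L661–L668, §2 ((TL), (monoid), link patterns).
* L. H. Kauffman, *Knots and Physics* (1991), Part I §7 Prop. 7.5.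

## Mathlib / tree
Tree: `MarkedLoopTemperleyLieb.lean`, `MarkedLoopBraidTwist.lean` (`braidLin_*` pattern), `MarkedLoopBraidRotation.lean` (`solWRot_apply_outermost`, `gonNext`, `gonCap`),
`MarkedLoopTripodCharacter.lean` (`rotOp`, `rotOp_apply`, `rotOp_succ`, `rotOp_zero`, `rotOp_self_eq_zero'`, `patMap_congr`, `trace_solWRot_pow_eq_zero`),
`MarkedLoopTripodBasis.lean` (`solWEquiv`, `pat₀EquivNCMatching`). Mathlib: `LinearEquiv.funCongrLeft`, `LinearEquiv.conj_*`, `LinearMap.trace_conj'`, `LinearMap.trace_one`.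
-/

open Finset

namespace Literature.Probability.Percolation.MarkedLoops

open Literature.Probability.Percolation.FivePoint (tau)
open Literature.Probability.LatticeModels.TemperleyLieb (PerfectMatching IsNonCrossing LinkPattern)

section Coords

variable {n : ℕ}

/-- **outermost patterns of `k` marks ≃ link patterns on `k+1` sites** (close the disorder up to the new site `*`, then read the pairing).
[cite: KhristoforovSmirnov2021, §1.2 (arXiv v1 p. 2); PearceRittenbergDeGierNienhuis2002, §2 (link patterns)] -/
noncomputable def pat₀EquivLinkPattern (k : ℕ) : Pat₀ k ≃ LinkPattern (k + 1) :=
  (pat₀EquivNCMatching k).trans (ncMatchingEquivLinkPattern (k + 1))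

/-- the equivalence is `toPM ∘ closeUp`. [cite: KhristoforovSmirnov2021, §1.2 (arXiv v1 p. 2)] -/
theorem pat₀EquivLinkPattern_apply (k : ℕ) (q : Pat₀ k) : (pat₀EquivLinkPattern k q).1 = (closeUp q).toPM := rfl

/-- ★★ **THE TRIPOD-LAW SOLUTION SPACE IS THE SPACE OF FUNCTIONS ON PEARCE–RITTENBERG–DE GIER–NIENHUIS LINK PATTERNS OF `k+1` SITES** (a linear equivalence:
restrict to the outermost patterns, re-index by `pat₀EquivLinkPattern`). [cite: KhristoforovSmirnov2021, §2 Lemma 4 (arXiv v1 p. 4); PearceRittenbergDeGierNienhuis2002, §2] -/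
noncomputable def solWLinkEquiv (k : ℕ) : solW k ≃ₗ[ℂ] (LinkPattern (k + 1) → ℂ) :=
  (solWEquiv k).trans (LinearEquiv.funCongrLeft ℂ ℂ (pat₀EquivLinkPattern k).symm)

/-- the coordinates evaluated: the value of `w` at the outermost pattern behind the link pattern. [cite: KhristoforovSmirnov2021, §2 Lemma 4 (arXiv v1 p. 4)] -/
theorem solWLinkEquiv_apply (k : ℕ) (w : solW k) (P : LinkPattern (k + 1)) :
    solWLinkEquiv k w P = w.1 ((pat₀EquivLinkPattern k).symm P).1 := rfl

/-- the dimension in these coordinates: `dim solW k = #LinkPattern (k+1)` (Catalan for odd `k`, via the lineage's `card_ncMatching_eq`).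
[cite: KhristoforovSmirnov2021, §2 Lemma 4 (arXiv v1 p. 4); PearceRittenbergDeGierNienhuis2002, §2 (`C_{L,m}`)] -/
theorem finrank_solW_eq_card_linkPattern (k : ℕ) : Module.finrank ℂ (solW k) = Fintype.card (LinkPattern (k + 1)) := by
  rw [finrank_solW, Fintype.card_congr (pat₀EquivLinkPattern k)]

/-- **the polygon rotation of a link pattern** (relabel along `finRotate (k+1)`; planar by the bridge file). [cite: KhristoforovSmirnov2021, §1.2 (arXiv v1 p. 2: cyclic indexing); PearceRittenbergDeGierNienhuis2002, §2] -/
noncomputable def lpRot (P : LinkPattern (n + 1 + 1)) : LinkPattern (n + 1 + 1) :=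
  ⟨pmRelabel (rot (n + 1 + 1)) P.1, by simpa only [pow_one] using isNonCrossing_pmRelabel_rot_pow P 1⟩

/-- the rotated pairing. [cite: KhristoforovSmirnov2021, §1.2 (arXiv v1 p. 2)] -/
theorem lpRot_val (P : LinkPattern (n + 1 + 1)) : (lpRot P).1 = pmRelabel (rot (n + 1 + 1)) P.1 := rfl

/-- **the capped rotation**: Pearce–Rittenberg–de Gier–Nienhuis's move `connect * 0` after the polygon rotation (a link pattern, `linkPatternCapLastZero`).
[cite: PearceRittenbergDeGierNienhuis2002, §2 (monoid)] -/
noncomputable def lpCapRot (P : LinkPattern (n + 1 + 1)) : LinkPattern (n + 1 + 1) := linkPatternCapLastZero (lpRot P)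

/-- the capped rotated pairing. [cite: PearceRittenbergDeGierNienhuis2002, §2 (monoid)] -/
theorem lpCapRot_val (P : LinkPattern (n + 1 + 1)) : (lpCapRot P).1 = (pmRelabel (rot (n + 1 + 1)) P.1).connect (Fin.last (n + 1)) 0 := rfl

/-- ★ **the polygon rotation of the link pattern of `q` is the link pattern of `gonNext q`.** [cite: KhristoforovSmirnov2021, §1.2 (arXiv v1 p. 2)] -/
theorem lpRot_pat₀EquivLinkPattern (q : Pat₀ (n + 1)) : lpRot (pat₀EquivLinkPattern (n + 1) q) = pat₀EquivLinkPattern (n + 1) (gonNext q) :=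
  Subtype.ext (by rw [lpRot_val, pat₀EquivLinkPattern_apply, pat₀EquivLinkPattern_apply, toPM_closeUp_gonNext])

/-- ★ **the capped rotation of the link pattern of `q` is the link pattern of `gonCap q`.** [cite: KhristoforovSmirnov2021, §2 Lemma 4, Fig. 3 (arXiv v1 p. 4); PearceRittenbergDeGierNienhuis2002, §2 (monoid)] -/
theorem lpCapRot_pat₀EquivLinkPattern (q : Pat₀ (n + 1)) : lpCapRot (pat₀EquivLinkPattern (n + 1) q) = pat₀EquivLinkPattern (n + 1) (gonCap q) :=
  Subtype.ext (by rw [lpCapRot_val, pat₀EquivLinkPattern_apply, pat₀EquivLinkPattern_apply, toPM_closeUp_gonCap, toPM_closeUp_gonNext])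

/-- ★ **THE TEMPERLEY–LIEB BRAID ON LINK-PATTERN COORDINATES**: `(B φ)(P) = (−τ)·φ(ρP) + (−τ²)·φ((ρP).connect * 0)` — Kauffman's `A⁻¹·1 + A·e` composed with the
polygon rotation, `e = e_{*,0}` Pearce–Rittenberg–de Gier–Nienhuis's move at loop weight one.
[cite: Kauffman1991KnotsPhysics, Part I §7 Prop. 7.5 (ρ(σ_i) = A + A⁻¹U_i); PearceRittenbergDeGierNienhuis2002, §2 (monoid); KhristoforovSmirnov2021, §1.2 (arXiv v1 p. 2)] -/
noncomputable def tlBraid : (LinkPattern (n + 1 + 1) → ℂ) →ₗ[ℂ] (LinkPattern (n + 1 + 1) → ℂ) where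
  toFun φ P := (-tau) * φ (lpRot P) + (-tau ^ 2) * φ (lpCapRot P)
  map_add' φ ψ := by
    funext P
    simp only [Pi.add_apply]
    ring
  map_smul' c φ := by
    funext P
    simp only [Pi.smul_apply, smul_eq_mul, RingHom.id_apply]
    ring

/-- the braid evaluated. [cite: PearceRittenbergDeGierNienhuis2002, §2; KhristoforovSmirnov2021, §1.2 (arXiv v1 p. 2)] -/
theorem tlBraid_apply (φ : LinkPattern (n + 1 + 1) → ℂ) (P : LinkPattern (n + 1 + 1)) :
    tlBraid φ P = (-tau) * φ (lpRot P) + (-tau ^ 2) * φ (lpCapRot P) := rfl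

/-- ★★★ **IN LINK-PATTERN COORDINATES THE RELABELLING ROTATION OF KHRISTOFOROV–SMIRNOV'S `k` MARKS IS THE TEMPERLEY–LIEB BRAID**:
`solWLinkEquiv (rot·w) = tlBraid (solWLinkEquiv w)` for every tripod-law solution `w`.
[cite: KhristoforovSmirnov2021, §2 Lemma 4, proof and Fig. 3 (arXiv v1 p. 4); PearceRittenbergDeGierNienhuis2002, §2 (TL), (monoid); Kauffman1991KnotsPhysics, Part I §7 Prop. 7.5] -/
theorem solWLinkEquiv_solWRot (w : solW (n + 1)) :
    solWLinkEquiv (n + 1) (solWRot (n + 1) (rot (n + 1)) isCyc_rot w) = tlBraid (solWLinkEquiv (n + 1) w) := by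
  funext P
  obtain ⟨q, rfl⟩ := (pat₀EquivLinkPattern (n + 1)).surjective P
  rw [tlBraid_apply, lpCapRot_pat₀EquivLinkPattern, lpRot_pat₀EquivLinkPattern, solWLinkEquiv_apply, solWLinkEquiv_apply, solWLinkEquiv_apply,
    Equiv.symm_apply_apply, Equiv.symm_apply_apply, Equiv.symm_apply_apply]
  exact solWRot_apply_outermost w q

/-- the first power of the mark rotation is the rotation (bookkeeping: `rot^1 = rot`). [cite: KhristoforovSmirnov2021, §1.2 (arXiv v1 p. 2: cyclic indexing)] -/
theorem rotOp_one_apply_eq (w : solW (n + 1)) : rotOp (n + 1) 1 w = solWRot (n + 1) (rot (n + 1)) isCyc_rot w :=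
  Subtype.ext (funext fun p => congrArg w.1 (patMap_congr (isCyc_rot_pow 1) isCyc_rot (pow_one _) p))

/-- ★★ **CONJUGACY**: `tlBraid = solWLinkEquiv ∘ R₁ ∘ solWLinkEquiv⁻¹`. [cite: KhristoforovSmirnov2021, §2 Lemma 4 (arXiv v1 p. 4); §1.2 (p. 2: cyclic indexing)] -/
theorem tlBraid_eq_conj : (tlBraid : Module.End ℂ (LinkPattern (n + 1 + 1) → ℂ)) = (solWLinkEquiv (n + 1)).conj (rotOp (n + 1) 1) := by
  apply LinearMap.ext
  intro φ
  rw [LinearEquiv.conj_apply_apply, rotOp_one_apply_eq, solWLinkEquiv_solWRot, LinearEquiv.apply_symm_apply]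

/-- ★★ the powers of the braid are conjugate to the powers of the mark rotation. [cite: KhristoforovSmirnov2021, §1.2 (arXiv v1 p. 2: cyclic indexing)] -/
theorem tlBraid_pow (m : ℕ) : (tlBraid : Module.End ℂ (LinkPattern (n + 1 + 1) → ℂ)) ^ m = (solWLinkEquiv (n + 1)).conj (rotOp (n + 1) m) := by
  induction m with
  | zero => rw [pow_zero, rotOp_zero, LinearEquiv.conj_id]; rfl
  | succ m ih => rw [pow_succ', ih, rotOp_succ, LinearEquiv.conj_comp, tlBraid_eq_conj]; rfl

/-- ★★★ **THE FULL TWIST IS TRIVIAL ON LINK PATTERNS**: `tlBraid ^ k = 1` on `LinkPattern (k+1) → ℂ` (`k = n+1`).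
[cite: Kauffman1991KnotsPhysics, Part I §7 Prop. 7.5; KhristoforovSmirnov2021, §1.2 (arXiv v1 p. 2: cyclic indexing)] -/
theorem tlBraid_pow_marks : (tlBraid : Module.End ℂ (LinkPattern (n + 1 + 1) → ℂ)) ^ (n + 1) = 1 := by
  rw [tlBraid_pow, rotOp_self_eq_zero', rotOp_zero, LinearEquiv.conj_id]; rfl

/-- ★★ **the character of the Temperley–Lieb braid on link patterns vanishes off multiples of `k` when `3 ∤ k`.**
[cite: KhristoforovSmirnov2021, §2 Lemma 4 (arXiv v1 p. 4); §1.2 (p. 2)] -/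
theorem trace_tlBraid_pow_eq_zero (h3 : Nat.Coprime 3 (n + 1)) {r : ℕ} (hr : ¬ (n + 1) ∣ r) :
    LinearMap.trace ℂ (LinkPattern (n + 1 + 1) → ℂ) ((tlBraid : Module.End ℂ (LinkPattern (n + 1 + 1) → ℂ)) ^ r) = 0 := by
  rw [tlBraid_pow, LinearMap.trace_conj']
  exact trace_solWRot_pow_eq_zero h3 hr

/-- the character at the full twist is the number of link patterns. [cite: PearceRittenbergDeGierNienhuis2002, §2 (`C_{L,m}`); KhristoforovSmirnov2021, §1.2 (arXiv v1 p. 2)] -/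
theorem trace_tlBraid_pow_marks :
    LinearMap.trace ℂ (LinkPattern (n + 1 + 1) → ℂ) ((tlBraid : Module.End ℂ (LinkPattern (n + 1 + 1) → ℂ)) ^ (n + 1)) =
      Fintype.card (LinkPattern (n + 1 + 1)) := by
  rw [tlBraid_pow_marks, LinearMap.trace_one, Module.finrank_fintype_fun_eq_card]

end Coords

/-! ### (ed. 2) «TRIPOD-ROTINV» — the inverse rotation of the marks is the INVERSE Temperley–Lieb braid `A·ρ⁻¹ + A⁻¹·e_{k−1,*}∘ρ⁻¹` -/

section Inverse

variable {n : ℕ}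

/-- `τ³ = 1` and `1 + τ + τ² = 0`, read off the bridge file's skein constants. [cite: KhristoforovSmirnov2021, §2 Definition 3 (arXiv v1 p. 4: `τ = e^{2πi/3}`)] -/
private theorem tau_facts_inv : tau ^ 3 = 1 ∧ 1 + tau + tau ^ 2 = 0 := by
  have h1 := skeinA_mul_skeinAinv
  have h2 := skeinA_add_skeinAinv
  exact ⟨by linear_combination h1, by linear_combination -h2⟩

/-- **the inverse polygon rotation of a link pattern** (relabel along `ρ^k = ρ⁻¹` on the `k+1 = n+2` sites; planar by the bridge file).
[cite: KhristoforovSmirnov2021, §1.2 (arXiv v1 p. 2: cyclic indexing); PearceRittenbergDeGierNienhuis2002, §2] -/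
noncomputable def lpRotInv (P : LinkPattern (n + 1 + 1)) : LinkPattern (n + 1 + 1) :=
  ⟨pmRelabel (rot (n + 1 + 1) ^ (n + 1)) P.1, isNonCrossing_pmRelabel_rot_pow P (n + 1)⟩

/-- the inversely rotated pairing. [cite: KhristoforovSmirnov2021, §1.2 (arXiv v1 p. 2)] -/
theorem lpRotInv_val (P : LinkPattern (n + 1 + 1)) : (lpRotInv P).1 = pmRelabel (rot (n + 1 + 1) ^ (n + 1)) P.1 := rfl

/-- `ρ · ρ^k = 1` on `k+1` labels. [cite: KhristoforovSmirnov2021, §1.2 (arXiv v1 p. 2: cyclic indexing)] -/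
theorem rot_mul_rot_pow_pred : rot (n + 1 + 1) * rot (n + 1 + 1) ^ (n + 1) = 1 := by
  rw [← pow_succ', rot_pow_polygon]

/-- `ρ^k · ρ = 1` on `k+1` labels. [cite: KhristoforovSmirnov2021, §1.2 (arXiv v1 p. 2: cyclic indexing)] -/
theorem rot_pow_pred_mul_rot : rot (n + 1 + 1) ^ (n + 1) * rot (n + 1 + 1) = 1 := by
  rw [← pow_succ, rot_pow_polygon]

/-- `ρ (ρ⁻¹ P) = P`. [cite: KhristoforovSmirnov2021, §1.2 (arXiv v1 p. 2: cyclic indexing)] -/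
theorem lpRot_lpRotInv (P : LinkPattern (n + 1 + 1)) : lpRot (lpRotInv P) = P :=
  Subtype.ext (by rw [lpRot_val, lpRotInv_val, ← pmRelabel_mul, rot_mul_rot_pow_pred, pmRelabel_one])

/-- `ρ⁻¹ (ρ P) = P`. [cite: KhristoforovSmirnov2021, §1.2 (arXiv v1 p. 2: cyclic indexing)] -/
theorem lpRotInv_lpRot (P : LinkPattern (n + 1 + 1)) : lpRotInv (lpRot P) = P :=
  Subtype.ext (by rw [lpRotInv_val, lpRot_val, ← pmRelabel_mul, rot_pow_pred_mul_rot, pmRelabel_one])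

/-- **Pearce–Rittenberg–de Gier–Nienhuis's move at the edge `{k−1, *}`** (the last two sites `n`, `n+1` of `Fin (n+2)`) on link patterns — a link pattern
by the bridge file's `isNonCrossing_connect_succ` (a nearest-neighbour move). [cite: PearceRittenbergDeGierNienhuis2002, §2 (monoid)] -/
noncomputable def lpCapPred (P : LinkPattern (n + 1 + 1)) : LinkPattern (n + 1 + 1) :=
  ⟨P.1.connect (Fin.castSucc (Fin.last n)) (Fin.last n).succ, isNonCrossing_connect_succ P (Fin.last n)⟩

/-- the capped pairing at `{k−1, *}`. [cite: PearceRittenbergDeGierNienhuis2002, §2 (monoid)] -/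
theorem lpCapPred_val (P : LinkPattern (n + 1 + 1)) : (lpCapPred P).1 = P.1.connect (Fin.castSucc (Fin.last n)) (Fin.last n).succ := rfl

/-- the move is idempotent (the second application closes a loop, weight one). [cite: PearceRittenbergDeGierNienhuis2002, §2 (TL): `e² = e` at `q + q⁻¹ = 1`] -/
theorem lpCapPred_idem (P : LinkPattern (n + 1 + 1)) : lpCapPred (lpCapPred P) = lpCapPred P :=
  Subtype.ext (by rw [lpCapPred_val, lpCapPred_val, PerfectMatching.connect_connect])

/-- `ρ⁻¹` carries the site `*` (last) to `k−1`. [cite: KhristoforovSmirnov2021, §1.2 (arXiv v1 p. 2: cyclic indexing)] -/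
theorem rot_pow_pred_last : (rot (n + 1 + 1) ^ (n + 1)) (Fin.last (n + 1)) = Fin.castSucc (Fin.last n) := by
  apply Fin.ext
  rw [val_rot_pow, Fin.val_last, Fin.val_castSucc, Fin.val_last, show n + 1 + (n + 1) = n + (n + 1 + 1) by ring, Nat.add_mod_right,
    Nat.mod_eq_of_lt (by omega)]

/-- `ρ⁻¹` carries the site `0` to `*` (last). [cite: KhristoforovSmirnov2021, §1.2 (arXiv v1 p. 2: cyclic indexing)] -/
theorem rot_pow_pred_zero : (rot (n + 1 + 1) ^ (n + 1)) 0 = (Fin.last n).succ := by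
  apply Fin.ext
  rw [val_rot_pow, Fin.val_zero, zero_add, Nat.mod_eq_of_lt (by omega), Fin.val_succ, Fin.val_last]

/-- `ρ` carries `*` to `0`. [cite: KhristoforovSmirnov2021, §1.2 (arXiv v1 p. 2: cyclic indexing)] -/
theorem rot_succ_last : rot (n + 1 + 1) (Fin.last n).succ = 0 := by
  rw [Fin.succ_last]; exact rot_last

/-- ★ **conjugating the cap at `{*, 0}` by the rotation gives the cap at `{k−1, *}`**: `ρ⁻¹ (e_{*,0} P) = e_{k−1,*} (ρ⁻¹ P)`.
[cite: PearceRittenbergDeGierNienhuis2002, §2 (monoid); KhristoforovSmirnov2021, §1.2 (arXiv v1 p. 2: cyclic indexing)] -/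
theorem lpRotInv_linkPatternCapLastZero (P : LinkPattern (n + 1 + 1)) : lpRotInv (linkPatternCapLastZero P) = lpCapPred (lpRotInv P) := by
  apply Subtype.ext
  rw [lpRotInv_val, lpCapPred_val, lpRotInv_val, ← rot_pow_pred_last, ← rot_pow_pred_zero, connect_pmRelabel]
  rfl

/-- ★ the same conjugation forwards: `ρ (e_{k−1,*} P) = e_{*,0} (ρ P)`. [cite: PearceRittenbergDeGierNienhuis2002, §2 (monoid); KhristoforovSmirnov2021, §1.2 (arXiv v1 p. 2)] -/
theorem lpRot_lpCapPred (P : LinkPattern (n + 1 + 1)) : lpRot (lpCapPred P) = linkPatternCapLastZero (lpRot P) := by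
  apply Subtype.ext
  rw [lpRot_val, lpCapPred_val, ← connect_pmRelabel, rot_castSucc_last, rot_succ_last]
  rfl

/-- `ρ⁻¹ (e_{*,0} (ρ P)) = e_{k−1,*} P`. [cite: PearceRittenbergDeGierNienhuis2002, §2 (monoid); KhristoforovSmirnov2021, §1.2 (arXiv v1 p. 2)] -/
theorem lpRotInv_lpCapRot (P : LinkPattern (n + 1 + 1)) : lpRotInv (lpCapRot P) = lpCapPred P := by
  rw [lpCapRot, lpRotInv_linkPatternCapLastZero, lpRotInv_lpRot]

/-- `e_{*,0} ρ (ρ⁻¹ P) = e_{*,0} P`. [cite: PearceRittenbergDeGierNienhuis2002, §2 (monoid); KhristoforovSmirnov2021, §1.2 (arXiv v1 p. 2)] -/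
theorem lpCapRot_lpRotInv (P : LinkPattern (n + 1 + 1)) : lpCapRot (lpRotInv P) = linkPatternCapLastZero P := by
  rw [lpCapRot, lpRot_lpRotInv]

/-- `e_{*,0} (ρ (e_{k−1,*} (ρ⁻¹ P))) = e_{*,0} P` (conjugate back and use idempotency). [cite: PearceRittenbergDeGierNienhuis2002, §2 (TL), (monoid)] -/
theorem lpCapRot_lpCapPred_lpRotInv (P : LinkPattern (n + 1 + 1)) : lpCapRot (lpCapPred (lpRotInv P)) = linkPatternCapLastZero P := by
  rw [lpCapRot, lpRot_lpCapPred, lpRot_lpRotInv, linkPatternCapLastZero_idem]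

/-- ★ **THE INVERSE TEMPERLEY–LIEB BRAID ON LINK-PATTERN COORDINATES**: `(B⁻¹ φ)(P) = (−τ²)·φ(ρ⁻¹P) + (−τ)·φ(e_{k−1,*} ρ⁻¹ P)` — Kauffman's inverse generator
`A·1 + A⁻¹·e` (`A = −τ²`, `A⁻¹ = −τ`; `σ⁻¹ = A⁻¹ + AU` for `σ = A + A⁻¹U`) composed with the inverse polygon rotation, the cap now at the edge `{k−1, *}`.
[cite: Kauffman1991KnotsPhysics, Part I §7: ρ(σᵢ) = A + A⁻¹Uᵢ, ρ(σᵢ⁻¹) = A⁻¹ + AUᵢ; Prop. 7.5; PearceRittenbergDeGierNienhuis2002, §2 (monoid); KhristoforovSmirnov2021, §1.2 (arXiv v1 p. 2)] -/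
noncomputable def tlBraidInv : (LinkPattern (n + 1 + 1) → ℂ) →ₗ[ℂ] (LinkPattern (n + 1 + 1) → ℂ) where
  toFun φ P := (-tau ^ 2) * φ (lpRotInv P) + (-tau) * φ (lpCapPred (lpRotInv P))
  map_add' φ ψ := by
    funext P
    simp only [Pi.add_apply]
    ring
  map_smul' c φ := by
    funext P
    simp only [Pi.smul_apply, smul_eq_mul, RingHom.id_apply]
    ring

/-- the inverse braid evaluated. [cite: Kauffman1991KnotsPhysics, Part I §7 (ρ(σᵢ⁻¹) = A⁻¹ + AUᵢ); KhristoforovSmirnov2021, §1.2 (arXiv v1 p. 2)] -/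
theorem tlBraidInv_apply (φ : LinkPattern (n + 1 + 1) → ℂ) (P : LinkPattern (n + 1 + 1)) :
    tlBraidInv φ P = (-tau ^ 2) * φ (lpRotInv P) + (-tau) * φ (lpCapPred (lpRotInv P)) := rfl

/-- ★★ **KAUFFMAN UNITARITY IN COORDINATES, I**: `B (B⁻¹ φ) = φ` — `(A⁻¹ + A e)(A + A⁻¹ e) = 1` at loop weight one because `A·A⁻¹ = 1` and `A² + 1 + A⁻² = τ + 1 + τ² = 0`
(`TemperleyLiebBraid.lean`'s `kauffman_mul_eq_one_of_one` is the abstract form). [cite: Kauffman1991KnotsPhysics, Part I §7 Prop. 7.5, proof step «First»; KhristoforovSmirnov2021, §1.2 (arXiv v1 p. 2)] -/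
theorem tlBraid_tlBraidInv (φ : LinkPattern (n + 1 + 1) → ℂ) : tlBraid (tlBraidInv φ) = φ := by
  obtain ⟨h3, hs⟩ := tau_facts_inv
  funext P
  rw [tlBraid_apply, tlBraidInv_apply, tlBraidInv_apply, lpRotInv_lpRot, lpRotInv_lpCapRot, lpCapPred_idem]
  linear_combination (φ P) * h3 + (tau ^ 2 * φ (lpCapPred P)) * hs

/-- ★★ **KAUFFMAN UNITARITY IN COORDINATES, II**: `B⁻¹ (B φ) = φ`. [cite: Kauffman1991KnotsPhysics, Part I §7 Prop. 7.5, proof step «First»; KhristoforovSmirnov2021, §1.2 (arXiv v1 p. 2)] -/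
theorem tlBraidInv_tlBraid (φ : LinkPattern (n + 1 + 1) → ℂ) : tlBraidInv (tlBraid φ) = φ := by
  obtain ⟨h3, hs⟩ := tau_facts_inv
  funext P
  rw [tlBraidInv_apply, tlBraid_apply, tlBraid_apply, lpRot_lpRotInv, lpCapRot_lpRotInv, lpRot_lpCapPred, lpRot_lpRotInv, lpCapRot_lpCapPred_lpRotInv]
  linear_combination (φ P) * h3 + (tau ^ 2 * φ (linkPatternCapLastZero P)) * hs

/-- as endomorphisms: `B * B⁻¹ = 1`. [cite: Kauffman1991KnotsPhysics, Part I §7 Prop. 7.5] -/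
theorem tlBraid_mul_tlBraidInv : (tlBraid : Module.End ℂ (LinkPattern (n + 1 + 1) → ℂ)) * tlBraidInv = 1 :=
  LinearMap.ext fun φ => tlBraid_tlBraidInv φ

/-- as endomorphisms: `B⁻¹ * B = 1`. [cite: Kauffman1991KnotsPhysics, Part I §7 Prop. 7.5] -/
theorem tlBraidInv_mul_tlBraid : (tlBraidInv : Module.End ℂ (LinkPattern (n + 1 + 1) → ℂ)) * tlBraid = 1 :=
  LinearMap.ext fun φ => tlBraidInv_tlBraid φ

/-- ★★ **THE INVERSE BRAID IS THE `(k−1)`-ST POWER OF THE BRAID** (the full twist being trivial, `tlBraid_pow_marks`): `B⁻¹ = B^{k−1}` on `LinkPattern (k+1) → ℂ`.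
[cite: Kauffman1991KnotsPhysics, Part I §7 Prop. 7.5; KhristoforovSmirnov2021, §1.2 (arXiv v1 p. 2: cyclic indexing)] -/
theorem tlBraidInv_eq_pow : (tlBraidInv : Module.End ℂ (LinkPattern (n + 1 + 1) → ℂ)) = tlBraid ^ n := by
  have h : (tlBraidInv : Module.End ℂ (LinkPattern (n + 1 + 1) → ℂ)) * tlBraid ^ (n + 1) = tlBraid ^ n := by
    rw [pow_succ', ← mul_assoc, tlBraidInv_mul_tlBraid, one_mul]
  rw [tlBraid_pow_marks, mul_one] at h
  exact h

/-- `R₁ ∘ R_{k−1} = id` on the solution space (`rot^k = 1`). [cite: KhristoforovSmirnov2021, §1.2 (arXiv v1 p. 2: cyclic indexing)] -/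
theorem rotOp_one_comp_rotOp_pred : rotOp (n + 1) 1 ∘ₗ rotOp (n + 1) n = LinearMap.id := by
  rw [← rotOp_succ, rotOp_self_eq_zero', rotOp_zero]

/-- the `(k−1)`-st power of the mark rotation is the INVERSE mark rotation. [cite: KhristoforovSmirnov2021, §1.2 (arXiv v1 p. 2: cyclic indexing)] -/
theorem rotOp_pred_eq_symm (w : solW (n + 1)) : rotOp (n + 1) n w = (solWRot (n + 1) (rot (n + 1)) isCyc_rot).symm w := by
  have h : rotOp (n + 1) 1 (rotOp (n + 1) n w) = w := by
    rw [← LinearMap.comp_apply, rotOp_one_comp_rotOp_pred, LinearMap.id_apply]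
  rw [rotOp_one_apply_eq] at h
  rw [← h, LinearEquiv.symm_apply_apply, h]

/-- ★★★ **«TRIPOD-ROTINV»: IN LINK-PATTERN COORDINATES THE INVERSE ROTATION OF KHRISTOFOROV–SMIRNOV'S `k` MARKS IS THE INVERSE TEMPERLEY–LIEB BRAID** —
`solWLinkEquiv (rot⁻¹·w) = tlBraidInv (solWLinkEquiv w)`, i.e. for every tripod-law solution `w` and every link pattern `S` of the `(k+1)`-gon
**`(rot⁻¹·w)(S) = A·w(ρ⁻¹S) + A⁻¹·w(e_{k−1,*} ρ⁻¹ S)`**, `A = −τ²`, `A⁻¹ = −τ` (the companion of `solWLinkEquiv_solWRot`: `(rot·w)(S) = A⁻¹·w(ρS) + A·w(e_{*,0} ρ S)`;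
the lane's exact `ℤ[τ]` check of this formula for `k ≤ 13` is `HOME/FINDING-TRIPOD-SKEIN.md` §2).
[cite: KhristoforovSmirnov2021, §2 Lemma 4, proof and Fig. 3 (arXiv v1 p. 4); §1.2 (p. 2: cyclic indexing); Kauffman1991KnotsPhysics, Part I §7 (ρ(σᵢ⁻¹) = A⁻¹ + AUᵢ), Prop. 7.5; PearceRittenbergDeGierNienhuis2002, §2 (monoid)] -/
theorem solWLinkEquiv_solWRot_symm (w : solW (n + 1)) :
    solWLinkEquiv (n + 1) ((solWRot (n + 1) (rot (n + 1)) isCyc_rot).symm w) = tlBraidInv (solWLinkEquiv (n + 1) w) := by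
  have h := LinearMap.congr_fun (tlBraidInv_eq_pow (n := n)) (solWLinkEquiv (n + 1) w)
  rw [h, tlBraid_pow, LinearEquiv.conj_apply_apply, LinearEquiv.symm_apply_apply, rotOp_pred_eq_symm]

/-- the same for the `(k−1)`-st power of the rotation operator: `solWLinkEquiv (R_{k−1} w) = tlBraidInv (solWLinkEquiv w)`.
[cite: KhristoforovSmirnov2021, §1.2 (arXiv v1 p. 2: cyclic indexing); Kauffman1991KnotsPhysics, Part I §7 Prop. 7.5] -/
theorem solWLinkEquiv_rotOp_pred (w : solW (n + 1)) : solWLinkEquiv (n + 1) (rotOp (n + 1) n w) = tlBraidInv (solWLinkEquiv (n + 1) w) := by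
  rw [rotOp_pred_eq_symm, solWLinkEquiv_solWRot_symm]

/-- ★★ **THE INVERSE ROTATION ON OUTERMOST PATTERNS** (pattern form of «TRIPOD-ROTINV»): for `w ∈ solW k` and an outermost pattern `q`,
`(rot⁻¹·w)(q) = (−τ²)·w(q⁻) + (−τ)·w(q⁻_cap)` where `q⁻`, `q⁻_cap` are the outermost patterns whose link patterns are `ρ⁻¹ S(q)` and `e_{k−1,*} ρ⁻¹ S(q)`.
[cite: KhristoforovSmirnov2021, §2 Lemma 4, proof and Fig. 3 (arXiv v1 p. 4); §1.2 (p. 2); Kauffman1991KnotsPhysics, Part I §7 Prop. 7.5] -/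
theorem solWRot_symm_apply_outermost (w : solW (n + 1)) (q : Pat₀ (n + 1)) :
    ((solWRot (n + 1) (rot (n + 1)) isCyc_rot).symm w).1 q.1 =
      (-tau ^ 2) * w.1 ((pat₀EquivLinkPattern (n + 1)).symm (lpRotInv (pat₀EquivLinkPattern (n + 1) q))).1 +
        (-tau) * w.1 ((pat₀EquivLinkPattern (n + 1)).symm (lpCapPred (lpRotInv (pat₀EquivLinkPattern (n + 1) q)))).1 := by
  have h := congrFun (solWLinkEquiv_solWRot_symm w) (pat₀EquivLinkPattern (n + 1) q)
  rw [solWLinkEquiv_apply, Equiv.symm_apply_apply, tlBraidInv_apply, solWLinkEquiv_apply, solWLinkEquiv_apply] at h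
  exact h

end Inverse

end Literature.Probability.Percolation.MarkedLoops
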